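import Summits.CriticalPhenomena.Ising3DConformalLimit.Theses.MonotoneBlocking
import Summits.CriticalPhenomena.Ising3DConformalLimit.Theses.MirrorHoelderCompactness
import Literature.Probability.LatticeModels.HighDimPointwiseTriviality
import Literature.Probability.LatticeModels.CriticalScalingDimension
import Summits.CriticalPhenomena.Ising3DConformalLimit.Theorems.MoebiusLimitExists.Negative.LocalBoundsDoubling
import HarnessLib

/-!
# `NonSeparableModulus` (stmt-CriticalPhenomena-6152): `NonCoincident` and compactness are load-bearing

Negative knowledge about the crux `…Theses.MonotoneBlocking.NonSeparableModulus` (NS; the same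
proposition as `…Theses.MirrorHoelderCompactness.NonSeparableModulus`, `mirror_nonSeparableModulus_iff`),
standing crux disprover (D-0016); THEOREM-ONLY (no definitions — the two variants of the crux are
written out verbatim), supports the item, closes nothing. Split of §1–§2 of the work file
`Summits/CriticalPhenomena/Ising3DConformalLimit/Cruxes/NonSeparableModulus/Disproof.lean`.

NS: for every `n`, compact `K ⊆ NonCoincident 3 n`, `ε > 0` there are `m, η, δ₀ > 0` with
`|F_n^δ(update x i y) − F_n^δ(x)| < ε` whenever `δ < δ₀`, `x ∈ K`, `‖y − x i‖ < η` and `(x, i)` is not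
`m`-separable by a nine-normal; `F_n^δ = ρ★(δ)ⁿ⟨∏σ_{⌊x_k/δ⌋}⟩_{β_c(3)}`, `ρ★(δ) = ⟨σ₀σ_{⌊δ⁻¹⌋e₀}⟩^{-1/2}`.

* `nonSeparableModulus_false_without_nonCoincident` — NS with the hypothesis `K ⊆ NonCoincident 3 n`
  deleted is FALSE: witness `n = 2`, `K = {(0,0)}` (compact; the moving point is tied with its partner,
  hence never separable by any vector).
* `nonSeparableModulus_false_without_compact` — NS with the hypothesis `IsCompact K` deleted is FALSE:
  witness `n = 2`, `K = NonCoincident 3 2`, pairs `(0, (δ/2)e₀)` (non-coincident, all nine inner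
  products `≤ δ/2 < m`, yet lattice-coincident at mesh `δ`).
  Both by the LATTICE-COINCIDENCE mechanism (`exists_mesh_jump`): at a lattice-coincident pair the
  pinned zoom is `ρ★(δ)² = 1/g(⌊δ⁻¹⌋)`, which the infrared bound `g(N) ≤ C/N` sends to `∞`; the move
  by `η/2` along `e₀` lands `R = ⌊η/2δ⌋` cells away where `⟨σ₀σ_{Re₀}⟩ ≤ C/R ≤ ½` — a jump `≥ 1`.
  Moral for provers: `δ₀ = δ₀(K) ≪ sep K` is where both hypotheses enter, and nothing else in NS
  excludes lattice coincidence of distinct points (see also `Negative/MeshThreshold.lean`: the order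
  `∀ K ∃ δ₀` cannot be reversed).

Tools: `criticalCorr_two_pair`, `criticalTwoPoint_zero'/neg`, `criticalTwoPoint_bounds_holds`
(`HighDimPointwiseTriviality`, `CriticalTwoPointBounds`), `latticeApprox_zero` (`CriticalScalingDimension`),
`latticeApprox_single_zero` (`MoebiusLimitExists/Negative/LocalBoundsDoubling`). References: Friedli–Velenik 2017 Thm 3.17/3.20
[FriedliVelenik2017]; Fröhlich–Simon–Spencer 1976 / Duminil-Copin 2019 Thm 4.8 (infrared bound)
[DuminilCopin2019].
-/

noncomputable section

namespace Summit.CriticalPhenomena.Ising3DConformalLimit.NonSeparableModulusNegative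

open Literature.Probability.LatticeModels
open Summit.CriticalPhenomena.Ising3DConformalLimit.Theses
open Summit.CriticalPhenomena.Ising3DConformalLimit.MoebiusLimitExistsNegative (latticeApprox_single_zero)

/-- The two route copies of the crux are one proposition. [folklore] -/
theorem mirror_nonSeparableModulus_iff :
    MirrorHoelderCompactness.NonSeparableModulus ↔ MonotoneBlocking.NonSeparableModulus :=
  Iff.rfl

/-! ## Axis dictionary -/

/-- `0 < ⟨σ₀σ_{ke₀}⟩_{β_c}` (Simon–Lieb lower bound; `= 1` at `k = 0`). [folklore] -/
theorem axis_pos (k : ℤ) : 0 < criticalTwoPoint 3 (Pi.single 0 k) := by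
  by_cases hk : k = 0
  · subst hk; simp [criticalTwoPoint_zero']
  · obtain ⟨c, C, hc, hb⟩ := criticalTwoPoint_bounds_holds (d := 3) le_rfl
    have hx : (Pi.single 0 k : Site 3) ≠ 0 := by
      intro h0; have := congr_fun h0 0; simp at this; exact hk this
    exact lt_of_lt_of_le (mul_pos hc (Real.rpow_pos_of_pos (norm_pos_iff.2 hx) _)) (hb _ hx).1

/-- The infrared bound on the axis: `⟨σ₀σ_{ke₀}⟩_{β_c} ≤ C / k` for `k ≥ 1`.
[cite: DuminilCopin2019, Thm. 4.8] -/
theorem axis_decay :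
    ∃ C : ℝ, 0 ≤ C ∧ ∀ k : ℤ, 0 < k → criticalTwoPoint 3 (Pi.single 0 k) ≤ C / k := by
  obtain ⟨c, C, -, hb⟩ := criticalTwoPoint_bounds_holds (d := 3) le_rfl
  refine ⟨max C 0, le_max_right _ _, fun k hk => ?_⟩
  have hx : (Pi.single 0 k : Site 3) ≠ 0 := by
    intro h0; have := congr_fun h0 0; simp at this; omega
  have h1 := (hb _ hx).2
  have hnorm : ‖(Pi.single 0 k : Site 3)‖ = (k : ℝ) := by
    rw [Pi.norm_single, Int.norm_eq_abs]
    exact abs_of_pos (by exact_mod_cast hk)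
  rw [hnorm, show (-(((3:ℕ) : ℝ) - 2)) = (-1 : ℝ) by norm_num, Real.rpow_neg_one] at h1
  have hkpos : (0 : ℝ) < k := by exact_mod_cast hk
  calc criticalTwoPoint 3 (Pi.single 0 k) ≤ C * (k : ℝ)⁻¹ := h1
    _ ≤ max C 0 * (k : ℝ)⁻¹ := mul_le_mul_of_nonneg_right (le_max_left _ _) (inv_nonneg.2 hkpos.le)
    _ = max C 0 / k := by rw [div_eq_mul_inv]

/-- `ρ★(δ)² = 1/⟨σ₀σ_{⌊δ⁻¹⌋e₀}⟩` for the pinning `ρ★(δ) = ⟨σ₀σ_{⌊δ⁻¹⌋e₀}⟩^{-1/2}` of the crux. [folklore] -/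
theorem rhoStar_sq (δ : ℝ) :
    ((criticalTwoPoint 3 (Pi.single 0 ⌊δ⁻¹⌋)) ^ (-(1/2:ℝ))) ^ 2 =
      (criticalTwoPoint 3 (Pi.single 0 ⌊δ⁻¹⌋))⁻¹ := by
  rw [← Real.rpow_natCast, ← Real.rpow_mul (axis_pos _).le]
  norm_num
  exact Real.rpow_neg_one _

/-- `‖t e₀‖ = |t|`. [folklore] -/
theorem norm_single0 (t : ℝ) : ‖(EuclideanSpace.single (0 : Fin 3) t : EuclideanSpace ℝ (Fin 3))‖ = |t| := by
  rw [PiLp.norm_single, Real.norm_eq_abs]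

/-- `⟨u, t e₀⟩ = t u₀`. [folklore] -/
theorem inner_single0 (u : EuclideanSpace ℝ (Fin 3)) (t : ℝ) :
    inner ℝ u (EuclideanSpace.single (0 : Fin 3) t) = t * u 0 := by
  rw [EuclideanSpace.inner_single_right]; simp

/-- The pinned pair zoom: `F_2^δ(p, q) = ⟨σ₀ σ_{[q/δ]−[p/δ]}⟩ / ⟨σ₀σ_{⌊δ⁻¹⌋e₀}⟩`. [folklore] -/
theorem rescaled_two_eq (δ : ℝ) (x : Fin 2 → EuclideanSpace ℝ (Fin 3)) :
    rescaledCorrelator (criticalCorr 3)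
        (fun δ : ℝ => (criticalTwoPoint 3 (Pi.single 0 ⌊δ⁻¹⌋)) ^ (-(1/2:ℝ))) 2 δ x =
      (criticalTwoPoint 3 (Pi.single 0 ⌊δ⁻¹⌋))⁻¹ *
        criticalTwoPoint 3 (latticeApprox δ (x 1) - latticeApprox δ (x 0)) := by
  rw [rescaledCorrelator_apply, rhoStar_sq]
  congr 1
  have : (fun i => latticeApprox δ (x i)) = ![latticeApprox δ (x 0), latticeApprox δ (x 1)] := by
    funext i; fin_cases i <;> rfl
  rw [this, criticalCorr_two_pair]

/-! ## The lattice-coincidence mechanism -/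

/-- Core estimate: for every `η, δ₀ > 0` and every extra smallness request `b > 0` there is a mesh
`δ < δ₀`, `δ ≤ b`, at which `1/g(N) − g(R)/g(N) ≥ 1`, `N = ⌊δ⁻¹⌋`, `R = ⌊η/2/δ⌋`,
`g(k) = ⟨σ₀σ_{ke₀}⟩_{β_c}` (both `g(N), g(R) ≤ ½` by the infrared bound). [folklore] -/
theorem exists_mesh_jump {η δ₀ b : ℝ} (hη : 0 < η) (hδ₀ : 0 < δ₀) (hb : 0 < b) :
    ∃ δ : ℝ, 0 < δ ∧ δ < δ₀ ∧ δ ≤ b ∧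
      1 ≤ (criticalTwoPoint 3 (Pi.single 0 ⌊δ⁻¹⌋))⁻¹ * 1 -
        (criticalTwoPoint 3 (Pi.single 0 ⌊δ⁻¹⌋))⁻¹ * criticalTwoPoint 3 (Pi.single 0 ⌊η / 2 / δ⌋) := by
  obtain ⟨C, hC0, hC⟩ := axis_decay
  set δ : ℝ := min (min (δ₀ / 2) b) (min (η / (4 * C + 4)) (1 / (2 * C + 2))) with hδdef
  have hA : 0 < 4 * C + 4 := by positivity
  have hB : 0 < 2 * C + 2 := by positivity
  have hδpos : 0 < δ := by
    rw [hδdef]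
    refine lt_min (lt_min (by positivity) hb) (lt_min (div_pos hη hA) (div_pos one_pos hB))
  have hδ₀' : δ < δ₀ := by
    have : δ ≤ δ₀ / 2 := (min_le_left _ _).trans (min_le_left _ _)
    linarith
  have hδb : δ ≤ b := (min_le_left _ _).trans (min_le_right _ _)
  have hδη : δ ≤ η / (4 * C + 4) := (min_le_right _ _).trans (min_le_left _ _)
  have hδ1 : δ ≤ 1 / (2 * C + 2) := (min_le_right _ _).trans (min_le_right _ _)
  refine ⟨δ, hδpos, hδ₀', hδb, ?_⟩
  set N : ℤ := ⌊δ⁻¹⌋ with hN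
  set R : ℤ := ⌊η / 2 / δ⌋ with hR
  have hNreal : 2 * C + 1 < (N : ℝ) := by
    have h1 : 2 * C + 2 ≤ δ⁻¹ := by
      rw [le_inv_comm₀ hB hδpos]; simpa [one_div] using hδ1
    have h2 := Int.sub_one_lt_floor δ⁻¹
    rw [← hN] at h2; linarith
  have hRreal : 2 * C + 1 < (R : ℝ) := by
    have h1 : 2 * C + 2 ≤ η / 2 / δ := by
      rw [le_div_iff₀ hδpos]
      have := (le_div_iff₀ hA).1 hδη
      linarith
    have h2 := Int.sub_one_lt_floor (η / 2 / δ)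
    rw [← hR] at h2; linarith
  have hNpos : (0 : ℝ) < N := by linarith
  have hRpos : (0 : ℝ) < R := by linarith
  have hN0 : 0 < N := by exact_mod_cast hNpos
  have hR0 : 0 < R := by exact_mod_cast hRpos
  have hgN : criticalTwoPoint 3 (Pi.single 0 N) ≤ 1 / 2 := by
    refine (hC N hN0).trans ?_
    rw [div_le_iff₀ hNpos]; linarith
  have hgR : criticalTwoPoint 3 (Pi.single 0 R) ≤ 1 / 2 := by
    refine (hC R hR0).trans ?_
    rw [div_le_iff₀ hRpos]; linarith
  have hgNpos := axis_pos N
  have hinv : 2 ≤ (criticalTwoPoint 3 (Pi.single 0 N))⁻¹ := by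
    rw [le_inv_comm₀ two_pos hgNpos]; linarith
  have : (criticalTwoPoint 3 (Pi.single 0 N))⁻¹ * 1 -
      (criticalTwoPoint 3 (Pi.single 0 N))⁻¹ * criticalTwoPoint 3 (Pi.single 0 R) =
      (criticalTwoPoint 3 (Pi.single 0 N))⁻¹ * (1 - criticalTwoPoint 3 (Pi.single 0 R)) := by ring
  rw [this]
  calc (1 : ℝ) = 2 * (1 / 2) := by norm_num
    _ ≤ (criticalTwoPoint 3 (Pi.single 0 N))⁻¹ * (1 - criticalTwoPoint 3 (Pi.single 0 R)) :=
      mul_le_mul hinv (by linarith) (by norm_num) (by positivity)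

/-- A tie cages: if `x j = x i` for some `j ≠ i`, then `x i` is neither `m`-ahead nor `m`-behind all
other points, along any vector `u` (`m > 0`). [folklore] -/
theorem not_caged_disjunction_of_eq {n : ℕ} {m : ℝ} (hm : 0 < m) {x : Fin n → EuclideanSpace ℝ (Fin 3)}
    {i j : Fin n} (hji : j ≠ i) (h : x j = x i) (u : EuclideanSpace ℝ (Fin 3)) :
    ¬ ((∀ j : Fin n, j ≠ i → inner ℝ u (x j) + m ≤ inner ℝ u (x i)) ∨
       (∀ j : Fin n, j ≠ i → inner ℝ u (x i) + m ≤ inner ℝ u (x j))) := by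
  rintro (hsep | hsep)
  · have := hsep j hji; rw [h] at this; linarith
  · have := hsep j hji; rw [h] at this; linarith

/-- Coordinates of a nine-normal are `0` or `±1`. [folklore] -/
theorem abs_apply_le_one_of_nineNormal {u : EuclideanSpace ℝ (Fin 3)}
    (hu : ∃ i j : Fin 3, i ≠ j ∧ (u = EuclideanSpace.single i 1 ∨
      u = EuclideanSpace.single i 1 + EuclideanSpace.single j 1 ∨
      u = EuclideanSpace.single i 1 - EuclideanSpace.single j 1)) (k : Fin 3) :
    |u k| ≤ 1 := by
  obtain ⟨i, j, hij, rfl | rfl | rfl⟩ := hu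
  · by_cases h1 : k = i
    · subst h1; simp
    · simp [h1]
  · by_cases h1 : k = i
    · subst h1; simp [hij]
    · by_cases h2 : k = j
      · subst h2; simp [h1]
      · simp [h1, h2]
  · by_cases h1 : k = i
    · subst h1; simp [hij]
    · by_cases h2 : k = j
      · subst h2; simp [h1]
      · simp [h1, h2]

/-- A pair `(0, t e₀)` with `|t| < m` is not `m`-separable at its first point by any nine-normal.
[folklore] -/
theorem not_nineSep_pair_small {m t : ℝ} (ht : |t| < m) {u : EuclideanSpace ℝ (Fin 3)}
    (hu : ∃ i j : Fin 3, i ≠ j ∧ (u = EuclideanSpace.single i 1 ∨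
      u = EuclideanSpace.single i 1 + EuclideanSpace.single j 1 ∨
      u = EuclideanSpace.single i 1 - EuclideanSpace.single j 1)) :
    ¬ ((∀ j : Fin 2, j ≠ 0 → inner ℝ u ((![0, EuclideanSpace.single 0 t] : Fin 2 → EuclideanSpace ℝ (Fin 3)) j) + m ≤
          inner ℝ u ((![0, EuclideanSpace.single 0 t] : Fin 2 → EuclideanSpace ℝ (Fin 3)) 0)) ∨
       (∀ j : Fin 2, j ≠ 0 → inner ℝ u ((![0, EuclideanSpace.single 0 t] : Fin 2 → EuclideanSpace ℝ (Fin 3)) 0) + m ≤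
          inner ℝ u ((![0, EuclideanSpace.single 0 t] : Fin 2 → EuclideanSpace ℝ (Fin 3)) j))) := by
  have hu0 := abs_apply_le_one_of_nineNormal hu 0
  have hbd : |t * u 0| ≤ |t| := by
    rw [abs_mul]; exact mul_le_of_le_one_right (abs_nonneg _) hu0
  rintro (hsep | hsep)
  · have h := hsep 1 (by decide)
    simp only [Matrix.cons_val_one, Matrix.cons_val_zero, Matrix.cons_val_fin_one, inner_zero_right,
      inner_single0] at h
    have := neg_abs_le (t * u 0)
    linarith
  · have h := hsep 1 (by decide)
    simp only [Matrix.cons_val_one, Matrix.cons_val_zero, Matrix.cons_val_fin_one, inner_zero_right,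
      inner_single0] at h
    have := le_abs_self (t * u 0)
    linarith

/-! ## The two load-bearing hypotheses -/

/-- **`K ⊆ NonCoincident` is load-bearing in NS.** The crux with that hypothesis deleted (everything
else verbatim) is false: at the coincident pair `K = {(0,0)}` (compact, `n = 2`; the moving point is
tied with its partner hence never `m`-separable) the pinned zoom is `1/g(⌊δ⁻¹⌋)` and the move
`0 ↦ (η/2)e₀` drops it to `g(⌊η/2δ⌋)/g(⌊δ⁻¹⌋) ≤ ½/g(⌊δ⁻¹⌋)`: a jump `≥ 1` at arbitrarily small
admissible meshes, against `ε = 1`. [folklore] -/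
theorem nonSeparableModulus_false_without_nonCoincident :
    ¬ (∀ (n : ℕ) (K : Set (Fin n → EuclideanSpace ℝ (Fin 3))), IsCompact K → ∀ ε : ℝ, 0 < ε →
      ∃ m η δ₀ : ℝ, 0 < m ∧ 0 < η ∧ 0 < δ₀ ∧ ∀ δ ∈ Set.Ioo 0 δ₀, ∀ x ∈ K,
      ∀ (i : Fin n) (y : EuclideanSpace ℝ (Fin 3)), ‖y - x i‖ < η →
      ¬ (∃ u : EuclideanSpace ℝ (Fin 3), (∃ i j : Fin 3, i ≠ j ∧ (u = EuclideanSpace.single i 1 ∨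
        u = EuclideanSpace.single i 1 + EuclideanSpace.single j 1 ∨
        u = EuclideanSpace.single i 1 - EuclideanSpace.single j 1)) ∧
        ((∀ j : Fin n, j ≠ i → inner ℝ u (x j) + m ≤ inner ℝ u (x i)) ∨
         (∀ j : Fin n, j ≠ i → inner ℝ u (x i) + m ≤ inner ℝ u (x j)))) →
      |rescaledCorrelator (criticalCorr 3)
          (fun δ : ℝ => (criticalTwoPoint 3 (Pi.single 0 ⌊δ⁻¹⌋)) ^ (-(1/2:ℝ))) n δ (Function.update x i y) -
        rescaledCorrelator (criticalCorr 3)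
          (fun δ : ℝ => (criticalTwoPoint 3 (Pi.single 0 ⌊δ⁻¹⌋)) ^ (-(1/2:ℝ))) n δ x| < ε) := by
  intro h
  obtain ⟨m, η, δ₀, hm, hη, hδ₀, hcl⟩ :=
    h 2 {fun _ => (0 : EuclideanSpace ℝ (Fin 3))} isCompact_singleton 1 one_pos
  obtain ⟨δ, hδ, hδδ₀, -, hjump⟩ := exists_mesh_jump hη hδ₀ one_pos
  set x : Fin 2 → EuclideanSpace ℝ (Fin 3) := fun _ => 0 with hx
  set y : EuclideanSpace ℝ (Fin 3) := EuclideanSpace.single 0 (η / 2) with hy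
  have hyx : ‖y - x 0‖ < η := by
    rw [hx, hy]; simp only [sub_zero, norm_single0]
    rw [abs_of_pos (by positivity)]; linarith
  have hns := fun hs : (∃ u : EuclideanSpace ℝ (Fin 3), (∃ i j : Fin 3, i ≠ j ∧
      (u = EuclideanSpace.single i 1 ∨ u = EuclideanSpace.single i 1 + EuclideanSpace.single j 1 ∨
        u = EuclideanSpace.single i 1 - EuclideanSpace.single j 1)) ∧
      ((∀ j : Fin 2, j ≠ 0 → inner ℝ u (x j) + m ≤ inner ℝ u (x 0)) ∨
        (∀ j : Fin 2, j ≠ 0 → inner ℝ u (x 0) + m ≤ inner ℝ u (x j)))) =>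
    hs.elim fun u hu => not_caged_disjunction_of_eq hm (j := 1) (i := 0) (by decide) rfl u hu.2
  have key := hcl δ ⟨hδ, hδδ₀⟩ x rfl 0 y hyx hns
  have hFx : rescaledCorrelator (criticalCorr 3)
      (fun δ : ℝ => (criticalTwoPoint 3 (Pi.single 0 ⌊δ⁻¹⌋)) ^ (-(1/2:ℝ))) 2 δ x =
      (criticalTwoPoint 3 (Pi.single 0 ⌊δ⁻¹⌋))⁻¹ * 1 := by
    rw [rescaled_two_eq, hx]
    simp only [latticeApprox_zero, sub_self, criticalTwoPoint_zero']
  have hFy : rescaledCorrelator (criticalCorr 3)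
      (fun δ : ℝ => (criticalTwoPoint 3 (Pi.single 0 ⌊δ⁻¹⌋)) ^ (-(1/2:ℝ))) 2 δ (Function.update x 0 y) =
      (criticalTwoPoint 3 (Pi.single 0 ⌊δ⁻¹⌋))⁻¹ * criticalTwoPoint 3 (Pi.single 0 ⌊η / 2 / δ⌋) := by
    rw [rescaled_two_eq, Function.update_of_ne (by decide), Function.update_self, hy,
      latticeApprox_single_zero]
    simp only [hx, latticeApprox_zero, zero_sub, criticalTwoPoint_neg]
  rw [hFx, hFy] at key
  have := neg_abs_le ((criticalTwoPoint 3 (Pi.single 0 ⌊δ⁻¹⌋))⁻¹ *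
      criticalTwoPoint 3 (Pi.single 0 ⌊η / 2 / δ⌋) - (criticalTwoPoint 3 (Pi.single 0 ⌊δ⁻¹⌋))⁻¹ * 1)
  linarith

/-- **`IsCompact K` is load-bearing in NS.** The crux with that hypothesis deleted (everything else
verbatim) is false on `K = NonCoincident 3 2` itself: the pairs `(0, (δ/2)e₀)` are non-coincident,
NOT `m`-separable once `δ < 2m` (all nine inner products are `≤ δ/2`), yet lattice-coincident at
mesh `δ`, so the same jump `≥ 1` occurs. The modulus cannot be uniform over `NonCoincident`:
`η, δ₀` must shrink with `sep K`. [folklore] -/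
theorem nonSeparableModulus_false_without_compact :
    ¬ (∀ (n : ℕ) (K : Set (Fin n → EuclideanSpace ℝ (Fin 3))), K ⊆ NonCoincident 3 n → ∀ ε : ℝ, 0 < ε →
      ∃ m η δ₀ : ℝ, 0 < m ∧ 0 < η ∧ 0 < δ₀ ∧ ∀ δ ∈ Set.Ioo 0 δ₀, ∀ x ∈ K,
      ∀ (i : Fin n) (y : EuclideanSpace ℝ (Fin 3)), ‖y - x i‖ < η →
      ¬ (∃ u : EuclideanSpace ℝ (Fin 3), (∃ i j : Fin 3, i ≠ j ∧ (u = EuclideanSpace.single i 1 ∨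
        u = EuclideanSpace.single i 1 + EuclideanSpace.single j 1 ∨
        u = EuclideanSpace.single i 1 - EuclideanSpace.single j 1)) ∧
        ((∀ j : Fin n, j ≠ i → inner ℝ u (x j) + m ≤ inner ℝ u (x i)) ∨
         (∀ j : Fin n, j ≠ i → inner ℝ u (x i) + m ≤ inner ℝ u (x j)))) →
      |rescaledCorrelator (criticalCorr 3)
          (fun δ : ℝ => (criticalTwoPoint 3 (Pi.single 0 ⌊δ⁻¹⌋)) ^ (-(1/2:ℝ))) n δ (Function.update x i y) -
        rescaledCorrelator (criticalCorr 3)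
          (fun δ : ℝ => (criticalTwoPoint 3 (Pi.single 0 ⌊δ⁻¹⌋)) ^ (-(1/2:ℝ))) n δ x| < ε) := by
  intro h
  obtain ⟨m, η, δ₀, hm, hη, hδ₀, hcl⟩ := h 2 (NonCoincident 3 2) subset_rfl 1 one_pos
  obtain ⟨δ, hδ, hδδ₀, hδm, hjump⟩ := exists_mesh_jump hη hδ₀ hm
  set x : Fin 2 → EuclideanSpace ℝ (Fin 3) := ![0, EuclideanSpace.single 0 (δ / 2)] with hx
  set y : EuclideanSpace ℝ (Fin 3) := EuclideanSpace.single 0 (η / 2) with hy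
  have hxK : x ∈ NonCoincident 3 2 := by
    refine pair_mem_nonCoincident fun h0 => ?_
    have := congrArg (fun v : EuclideanSpace ℝ (Fin 3) => ‖v‖) h0
    simp only [norm_zero, norm_single0] at this
    have : |δ / 2| = δ / 2 := abs_of_pos (by positivity)
    linarith
  have hyx : ‖y - x 0‖ < η := by
    rw [hx, hy]; simp only [Matrix.cons_val_zero, sub_zero, norm_single0]
    rw [abs_of_pos (by positivity)]; linarith
  have ht : |δ / 2| < m := by rw [abs_of_pos (by positivity)]; linarith
  have hns := fun hs : (∃ u : EuclideanSpace ℝ (Fin 3), (∃ i j : Fin 3, i ≠ j ∧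
      (u = EuclideanSpace.single i 1 ∨ u = EuclideanSpace.single i 1 + EuclideanSpace.single j 1 ∨
        u = EuclideanSpace.single i 1 - EuclideanSpace.single j 1)) ∧
      ((∀ j : Fin 2, j ≠ 0 → inner ℝ u (x j) + m ≤ inner ℝ u (x 0)) ∨
        (∀ j : Fin 2, j ≠ 0 → inner ℝ u (x 0) + m ≤ inner ℝ u (x j)))) =>
    hs.elim fun u hu => not_nineSep_pair_small ht hu.1 (by rw [hx] at hu; exact hu.2)
  have key := hcl δ ⟨hδ, hδδ₀⟩ x hxK 0 y hyx hns
  have hhalf : latticeApprox δ (EuclideanSpace.single (0 : Fin 3) (δ / 2)) = 0 := by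
    rw [latticeApprox_single_zero, show δ / 2 / δ = 1 / 2 by field_simp,
      show ⌊(1 / 2 : ℝ)⌋ = 0 by norm_num [Int.floor_eq_iff], Pi.single_zero]
  have hFx : rescaledCorrelator (criticalCorr 3)
      (fun δ : ℝ => (criticalTwoPoint 3 (Pi.single 0 ⌊δ⁻¹⌋)) ^ (-(1/2:ℝ))) 2 δ x =
      (criticalTwoPoint 3 (Pi.single 0 ⌊δ⁻¹⌋))⁻¹ * 1 := by
    rw [rescaled_two_eq, hx]
    simp only [Matrix.cons_val_one, Matrix.cons_val_zero, Matrix.cons_val_fin_one, hhalf,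
      latticeApprox_zero, sub_self, criticalTwoPoint_zero']
  have hFy : rescaledCorrelator (criticalCorr 3)
      (fun δ : ℝ => (criticalTwoPoint 3 (Pi.single 0 ⌊δ⁻¹⌋)) ^ (-(1/2:ℝ))) 2 δ (Function.update x 0 y) =
      (criticalTwoPoint 3 (Pi.single 0 ⌊δ⁻¹⌋))⁻¹ * criticalTwoPoint 3 (Pi.single 0 ⌊η / 2 / δ⌋) := by
    rw [rescaled_two_eq, Function.update_of_ne (by decide), Function.update_self, hy,
      latticeApprox_single_zero]
    simp only [hx, Matrix.cons_val_one, Matrix.cons_val_fin_one, hhalf, zero_sub, criticalTwoPoint_neg]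
  rw [hFx, hFy] at key
  have := neg_abs_le ((criticalTwoPoint 3 (Pi.single 0 ⌊δ⁻¹⌋))⁻¹ *
      criticalTwoPoint 3 (Pi.single 0 ⌊η / 2 / δ⌋) - (criticalTwoPoint 3 (Pi.single 0 ⌊δ⁻¹⌋))⁻¹ * 1)
  linarith

end Summit.CriticalPhenomena.Ising3DConformalLimit.NonSeparableModulusNegative

end
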